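import Literature.NumberTheory.Automorphic.UnitaryGroupKernelBorelClassHomogeneity
import Literature.NumberTheory.Automorphic.UnitaryGroupHeisenbergRegularTwistIntegral
import Literature.NumberTheory.Automorphic.UnitaryGroupHyperbolicBorelSlice
import Literature.NumberTheory.Automorphic.UnitaryGroupSingularBorelBasePoint
import Literature.NumberTheory.Automorphic.UnitaryGroupBorelTorusUnipotentCoordinates
import Literature.NumberTheory.Automorphic.IdeleModuleProofs
import HarnessLib

/-!
# Unfolding the class Borel LATTICE SUM over `N(F)\N(𝔸_F)` for an `N`-regular class of `U(3)`:
# `∫_{N(F)\N(𝔸)} Σ_{β ∈ B(F)∩𝔬̲} ψ(n⁻¹βn) dn = Σ_{t ∈ T(F)∩𝔬̲} ∫_{N(𝔸)} ψ(t u) du`, hence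
# `∫_{N(F)\N(𝔸)} (K_{B,𝔬}(n,n) − Σ_{β ∈ B(F)∩𝔬̲} ψ(n⁻¹βn)) dn = 0`
(Arthur, *A trace formula for reductive groups I*, Duke Math. J. 45 (1978), §8 — for an unramified class the
`N(F)`-conjugacy classes in `γN(F)` are parametrised by `N(F)` itself and `n ↦ γ⁻¹n⁻¹γn` has global Jacobian
`1`; Rogawski, *Automorphic Representations of Unitary Groups in Three Variables* (1990), §2.2 p. 13
(`K_{P,𝔬}`), §6.1 pp. 79–81, §7.3 p. 97 (the change of variables on `N`); Gelbart, *Automorphic forms on adele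
groups* (1975), §9.B)

Topic `NumberTheory/Automorphic`; namespace `Literature.NumberTheory.Automorphic.UnitaryGroup`. THEOREMS ONLY over
accepted tree modules: no definition, no named fact, no instance, no notation, no `sorry`. Item (L5-ii) **(W2-b)
FILE 2** of the T1-qs LAW 5 road (`Cruxes/H413/Lines/F0_T1InnerFormTraceIdentity.lean`, cell `pub/hodgecm-mathlib`,
crux H413; F0P3a-p05 (g6) WORDS 11:31:04Z ∕ 11:43:45Z). The heart of «`∫ R_T dμ = 0`»: with
`D_𝔬(y) := K_{B,𝔬}(y,y) − Σ_{β ∈ B(F)∩𝔬̲} f(y⁻¹βy)` («adelic `N`-average minus `B(F)∩𝔬̲`-lattice sum»), the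
`N(F)\N(𝔸_F)`-average of `D_𝔬` VANISHES at every point — PROVIDED every rational torus point of the class is
`N`-REGULAR (`d₀ ≠ d₁`, `d₀ ≠ d₂`: both roots of `T` in `N` are non-trivial on it). For the central class and the
singular class `d(a,b,a)` this fails (the `N(F)`-conjugation orbits in `tN(F)` with positive-dimensional
stabiliser produce [Rogawski1990, Prop. 7.3.2 (b)–(d), Prop. 7.2.2 (b)(c)]), so the hypothesis `hreg` below is
carried, in the idelic letters of ★ `diagUnit`:

  `hreg : ∀ β : B(F), cl β = 𝔬 → diagUnit β 0 ≠ diagUnit β 1 ∧ diagUnit β 0 ≠ diagUnit β 2`.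

* §1 rational torus points: `exists_rational_diagonal_of_rationalTorus` (a `t ∈ T(F)` is `ι(d(τ₀,τ₁,τ₂))` with
  `c(τ₂)τ₀ = c(τ₁)τ₁ = c(τ₀)τ₂ = 1` and `diagUnit t i = (τᵢ)_𝔸`), `ne_of_diagUnit_ne` (regularity descends to `τ`).
* §2 **THE RATIONAL TWIST IS A BIJECTION OF `N(F)`** for `N`-regular `t ∈ T(F)`:
  `exists_rationalUnipotent_inv_mul_mul_eq` (every `t n₀`, `n₀ ∈ N(F)`, is `η⁻¹ t η` with `η ∈ N(F)` — ★
  `exists_unipotent_conj_eq_corner` + ★ `exists_unipotent_conj_eq_diagonal_of_corner`, p05 (g6)),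
  `rationalUnipotent_eq_of_inv_mul_mul_eq` (uniqueness: regular rigidity ★ `offDiag_eq_zero_of_commute_diagonal`),
  **`exists_equiv_rationalUnipotent_twist`** (`e : N(F) ≃ N(F)` with `t · e(η) = η⁻¹ t η`).
* §3 **GLOBAL JACOBIAN ONE**: `integral_adelicUnipotent_inv_mul_mul_eq_of_rationalTorus` —
  `∫_{N(𝔸)} φ(u⁻¹ t u) dν = ∫_{N(𝔸)} φ(t u) dν` for `N`-regular RATIONAL `t` (★ W0 (III)
  `integral_adelicUnipotent_inv_mul_mul_eq_smul` with `k = (‖1 − τ₀⁻¹τ₁‖_𝔸 · χ⁻(1 − τ₀⁻¹τ₂))⁻¹ = 1` by the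
  product formula ★ `AdeleRing.distribHaarChar_principalIdeles` and ★ `traceZeroModulus_eq_sqrt`, ★ `exists_conjAdele_eq_neg`).
* §4 **`setIntegral_borelSumClass_diag_eq_tsum_integral`** — THE UNFOLDING: for a class map constant along `N(F)` on
  `B(F)` whose class `𝔬` is `N`-regular, a Haar measure `ν` of `N(𝔸_F)`, a fundamental domain `Ω` of `N(F)` and
  `ψ ∈ C_c(G(𝔸_F))`: `∫_Ω Σ_{β ∈ B(F)∩𝔬̲} ψ(n⁻¹βn) dν(n) = Σ'_{t ∈ T(F)∩𝔬̲} ∫_{N(𝔸)} ψ(t u) dν(u)`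
  (cells ★ `exists_equiv_borelClassCell_prod`, §2 per `t`, unfolding ★ `setIntegral_tsum_prod_smul_eq_tsum_integral`, §3).
* §5 **`setIntegral_kernelBorelClass_diag_sub_borelSumClass_diag_eq_zero`** — `∫_Ω (K_{B,𝔬}(n,n) − Σ_{B(F)∩𝔬̲} ψ(n⁻¹βn)) dν(n) = 0`
  (★ `kernelBorelClass_diag_eq_smul_tsum_integral`, ★ `kernelBorelClass_diag_borel_mul`, `ν(Ω) = ν(𝓕)`), and its
  translate **`setIntegral_kernelBorelClass_sub_borelSumClass_translate_eq_zero`**: `∫_Ω D_𝔬(n g₀) dν(n) = 0` for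
  every `g₀ ∈ G(𝔸_F)` — the input of (W2-b) FILE 3 after unfolding ∕ Iwasawa.

HONEST LABEL: no printed statement is consumed; HC_CM is proved only modulo the printed citations until rung 0
closes.

## References

* J. Arthur, *A trace formula for reductive groups I: terms associated to classes in `G(ℚ)`*, Duke Math. J. 45
  (1978), §8 [Arthur1978TraceFormulaI].
* J. D. Rogawski, *Automorphic Representations of Unitary Groups in Three Variables*, Annals of Mathematics
  Studies 123 (1990), §2.2 (p. 13), §6.1 (pp. 79–81), §7.3 (p. 97) [Rogawski1990].
* S. Gelbart, *Automorphic forms on adele groups*, Annals of Mathematics Studies 83 (1975), §9.B [Gelbart1975].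
* J. Tate, *Fourier analysis in number fields and Hecke's zeta-functions* (1967), Thm. 4.3.1 [TateThesis1967].
-/

set_option autoImplicit false

noncomputable section

open MeasureTheory Measure NumberField IsDedekindDomain Set Matrix
open scoped NNReal ENNReal MatrixGroups

namespace Literature.NumberTheory.Automorphic

namespace UnitaryGroup

variable {F E : Type} [Field F] [NumberField F] [Field E] [NumberField E] [Algebra F E]
  {c : E ≃ₐ[F] E} {ι : Type*}

/-! ## §0 Plumbing -/

/-- `𝔸_E` is Hausdorff (local copy of the standard three-line argument). [folklore] -/
private theorem t2Space_adeleRing_E₁₃ : T2Space (AdeleRing (𝓞 E) E) := by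
  haveI : T2Space (FiniteAdeleRing (𝓞 E) E) := inferInstanceAs <| T2Space
    (RestrictedProduct (fun w : HeightOneSpectrum (𝓞 E) => w.adicCompletion E)
      (fun w => (w.adicCompletionIntegers E : Set (w.adicCompletion E))) Filter.cofinite)
  haveI : T2Space (InfiniteAdeleRing E) :=
    inferInstanceAs <| T2Space ((w : InfinitePlace E) → w.Completion)
  exact inferInstanceAs <| T2Space (InfiniteAdeleRing E × FiniteAdeleRing (𝓞 E) E)

/-- `N(F)` and `T(F)` are countable (they inject into the countable `G(F)`; private plumbing, as in ★
`UnitaryGroupKernelBorelTorusFibration`). [folklore] -/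
private theorem countable_rationalUnipotent_rationalTorus₁₃ {N : ℕ} :
    Countable (rationalUnipotent F E c N) ∧ Countable (rationalTorus F E c N) := by
  haveI : Countable (quasiSplit F E c N).arithmeticSubgroup := by
    haveI : Countable E := NumberField.countable' (K := E)
    haveI : Countable (Matrix (Fin N) (Fin N) E) := inferInstanceAs (Countable (Fin N → Fin N → E))
    haveI : Countable (GL (Fin N) E) := Units.val_injective.countable
    haveI : Countable (quasiSplit F E c N).Rational :=
      inferInstanceAs (Countable (rational F E c N ((StdForm.antidiagonal N).over E)))
    exact (Set.countable_range _).to_subtype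
  have h1 : Function.Injective fun γ : rationalUnipotent F E c N =>
      (⟨((γ : adelicUnipotent F E c N) : (quasiSplit F E c N).Adelic), γ.2⟩ :
        (quasiSplit F E c N).arithmeticSubgroup) := fun a a' h =>
    Subtype.ext (Subtype.ext (congrArg
      (fun z : (quasiSplit F E c N).arithmeticSubgroup => (z : (quasiSplit F E c N).Adelic)) h))
  have h2 : Function.Injective fun t : rationalTorus F E c N =>
      (⟨((t : torusAdelic F E c N) : (quasiSplit F E c N).Adelic), t.2⟩ :
        (quasiSplit F E c N).arithmeticSubgroup) := fun a a' h =>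
    Subtype.ext (Subtype.ext (congrArg
      (fun z : (quasiSplit F E c N).arithmeticSubgroup => (z : (quasiSplit F E c N).Adelic)) h))
  exact ⟨h1.countable, h2.countable⟩

/-- The adelic matrix of `ι g` is the entrywise image of the rational matrix of `g` (definitional). [folklore] -/
private theorem coe_adelicVal_toAdelic₁₃ {N : ℕ} (g : (quasiSplit F E c N).Rational) :
    ((adelicVal F E c N _ ((quasiSplit F E c N).toAdelic g) : GL (Fin N) (AdeleRing (𝓞 E) E)) :
        Matrix (Fin N) (Fin N) (AdeleRing (𝓞 E) E)) =
      ((g.val : GL (Fin N) E) : Matrix (Fin N) (Fin N) E).map (algebraMap E (AdeleRing (𝓞 E) E)) :=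
  rfl

/-- The rational matrix of a product is the product of the rational matrices. [folklore] -/
private theorem coe_val_mul₁₃ {N : ℕ} (g h : (quasiSplit F E c N).Rational) :
    (((g * h).val : GL (Fin N) E) : Matrix (Fin N) (Fin N) E) =
      ((g.val : GL (Fin N) E) : Matrix (Fin N) (Fin N) E) * ((h.val : GL (Fin N) E) : Matrix (Fin N) (Fin N) E) := by
  rw [← Units.val_mul]; rfl

/-! ## §1 Rational torus points as rational diagonal matrices -/

section RationalTorus

/-- **A rational torus point is `ι(d(τ₀, τ₁, τ₂))`**: for `t ∈ T(F) ≤ T(𝔸_F)` there are `g ∈ U(J₃)(F)` with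
`ι g = t` and rational diagonal entries `τ` with `g = !![τ₀,0,0;0,τ₁,0;0,0,τ₂]`, the unitarity relations
`c(τ₂)τ₀ = c(τ₁)τ₁ = c(τ₀)τ₂ = 1`, and `diagUnit t i = (τᵢ)_𝔸` as idèles (the adelic matrix of `ι g` is the
entrywise image of the rational one, ★ `toAdelic_mem_borelAdelic_iff`; relations ★ `diag_relations_of_blockTriangular`).
[cite: Rogawski1990, §1.10; §3.6 (p. 27)] -/
theorem exists_rational_diagonal_of_rationalTorus (t : rationalTorus F E c 3) :
    ∃ (g : (quasiSplit F E c 3).Rational) (τ : Fin 3 → Eˣ),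
      ((t : torusAdelic F E c 3) : (quasiSplit F E c 3).Adelic) = (quasiSplit F E c 3).toAdelic g ∧
      ((g.val : GL (Fin 3) E) : Matrix (Fin 3) (Fin 3) E) = !![(τ 0 : E), 0, 0; 0, τ 1, 0; 0, 0, τ 2] ∧
      (c (τ 2 : E) * τ 0 = 1 ∧ c (τ 1 : E) * τ 1 = 1 ∧ c (τ 0 : E) * τ 2 = 1) ∧
      ∀ i, diagUnit (torusAdelic_le_borelAdelic (t : torusAdelic F E c 3).2) i =
        Units.map (algebraMap E (AdeleRing (𝓞 E) E) : E →* AdeleRing (𝓞 E) E) (τ i) := by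
  obtain ⟨g, hg⟩ := t.2
  have hg' : ((t : torusAdelic F E c 3) : (quasiSplit F E c 3).Adelic) = (quasiSplit F E c 3).toAdelic g := hg.symm
  obtain ⟨d, hd⟩ := (t : torusAdelic F E c 3).2
  have hinj := AdeleRing.algebraMap_injective (𝓞 E) E
  -- the adelic matrix of `t = ι g` is the diagonal `diag(d)` and the entrywise image of `g`
  have hmat : ∀ i j, algebraMap E (AdeleRing (𝓞 E) E) (((g.val : GL (Fin 3) E) : Matrix (Fin 3) (Fin 3) E) i j) =
      (Matrix.diagonal fun k => (d k : AdeleRing (𝓞 E) E)) i j := by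
    intro i j
    have h := congrArg (fun M : GL (Fin 3) (AdeleRing (𝓞 E) E) => (M : Matrix (Fin 3) (Fin 3) (AdeleRing (𝓞 E) E)) i j) hd
    simp only [coe_glDiagonal] at h
    rw [h, hg', coe_adelicVal_toAdelic₁₃, Matrix.map_apply]
  have hoff : ∀ i j, i ≠ j → ((g.val : GL (Fin 3) E) : Matrix (Fin 3) (Fin 3) E) i j = 0 := by
    intro i j hij
    have h := hmat i j
    rw [Matrix.diagonal_apply_ne _ hij] at h
    exact (map_eq_zero_iff _ hinj).1 h
  have hdiag : ∀ i, algebraMap E (AdeleRing (𝓞 E) E) (((g.val : GL (Fin 3) E) : Matrix (Fin 3) (Fin 3) E) i i) =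
      (d i : AdeleRing (𝓞 E) E) := fun i => by rw [hmat i i, Matrix.diagonal_apply_eq]
  have hne : ∀ i, ((g.val : GL (Fin 3) E) : Matrix (Fin 3) (Fin 3) E) i i ≠ 0 := by
    intro i h0
    haveI : Nontrivial (AdeleRing (𝓞 E) E) := ⟨⟨algebraMap E _ 0, algebraMap E _ 1, fun h => zero_ne_one (hinj h)⟩⟩
    have h := hdiag i
    rw [h0, map_zero] at h
    exact (d i).ne_zero h.symm
  set τ : Fin 3 → Eˣ := fun i => Units.mk0 _ (hne i) with hτ
  have hgmat : ((g.val : GL (Fin 3) E) : Matrix (Fin 3) (Fin 3) E) = !![(τ 0 : E), 0, 0; 0, τ 1, 0; 0, 0, τ 2] := by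
    ext i j
    fin_cases i <;> fin_cases j <;> first | exact hoff _ _ (by decide) | rfl
  have hB : (((g.val : GL (Fin 3) E) : Matrix (Fin 3) (Fin 3) E)).BlockTriangular id :=
    fun i j hij => hoff i j (ne_of_gt hij)
  obtain ⟨h0, h1, h2⟩ := diag_relations_of_blockTriangular hB
  clear_value τ
  refine ⟨g, τ, hg', hgmat, ⟨?_, ?_, ?_⟩, fun i => Units.ext ?_⟩
  · simpa [hgmat] using h0
  · simpa [hgmat] using h1
  · simpa [hgmat] using h2
  · rw [Units.coe_map, MonoidHom.coe_coe, coe_diagUnit, ← hd, coe_glDiagonal, Matrix.diagonal_apply_eq, ← hdiag i, hτ]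
    rfl

/-- Regularity descends from idèles to the rational entries: `diagUnit t i ≠ diagUnit t j ⇒ τᵢ ≠ τⱼ`.
[cite: Rogawski1990, §3.6 (p. 27)] -/
theorem ne_of_diagUnit_ne {t : rationalTorus F E c 3} {τ : Fin 3 → Eˣ}
    (hτ : ∀ i, diagUnit (torusAdelic_le_borelAdelic (t : torusAdelic F E c 3).2) i =
      Units.map (algebraMap E (AdeleRing (𝓞 E) E) : E →* AdeleRing (𝓞 E) E) (τ i))
    {i j : Fin 3}
    (hij : diagUnit (torusAdelic_le_borelAdelic (t : torusAdelic F E c 3).2) i ≠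
      diagUnit (torusAdelic_le_borelAdelic (t : torusAdelic F E c 3).2) j) :
    (τ i : E) ≠ τ j := by
  intro h
  apply hij
  rw [hτ i, hτ j, show τ i = τ j from Units.ext h]

omit [NumberField F] [NumberField E] in
/-- For a unitary diagonal `d(τ₀, τ₁, τ₂)` (`c(τ₁)τ₁ = 1`, `c(τ₀)τ₂ = 1`), `τ₀ ≠ τ₁` forces `τ₁ ≠ τ₂`
(else `c(τ₁) = c(τ₀)`). [cite: Rogawski1990, §3.6 (p. 27)] -/
theorem ne_one_two_of_ne_zero_one {τ : Fin 3 → Eˣ} (h1 : c (τ 1 : E) * τ 1 = 1) (h2 : c (τ 0 : E) * τ 2 = 1)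
    (h01 : (τ 0 : E) ≠ τ 1) : (τ 1 : E) ≠ τ 2 := by
  intro h12
  apply h01
  have hc : c (τ 1 : E) = c (τ 0 : E) := by
    have e : c (τ 1 : E) * (τ 1 : E) = c (τ 0 : E) * (τ 1 : E) := by rw [h1, h12, h2]
    exact mul_right_cancel₀ (τ 1).ne_zero e
  have := congrArg c hc
  simpa using this.symm

end RationalTorus

/-! ## §2 The rational twist `η ↦ t⁻¹η⁻¹tη` is a bijection of `N(F)` for `N`-regular `t ∈ T(F)` -/

section Twist

/-- **Every `t n₀` (`n₀ ∈ N(F)`) is `N(F)`-conjugate to `t`** for `t = ι(d(τ))` with `τ₀ ≠ τ₁`, `τ₀ ≠ τ₂`: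
`∃ η ∈ N(F), η⁻¹ t η = t n₀` — remove the `x`-coordinate (★ `exists_unipotent_conj_eq_corner`, root `τ₀∕τ₁ ≠ 1`),
then the corner (★ `exists_unipotent_conj_eq_diagonal_of_corner`, root `τ₀∕τ₂ ≠ 1`) (Arthur (1978) §8: for an
unramified class `γN(F) = {η⁻¹γη}`). [cite: Arthur1978TraceFormulaI, §8] [cite: Rogawski1990, §7.3 (p. 97)] -/
theorem exists_rationalUnipotent_inv_mul_mul_eq (hc : c * c = 1) {t : rationalTorus F E c 3}
    {g : (quasiSplit F E c 3).Rational} {τ : Fin 3 → Eˣ}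
    (hg : ((t : torusAdelic F E c 3) : (quasiSplit F E c 3).Adelic) = (quasiSplit F E c 3).toAdelic g)
    (hgmat : ((g.val : GL (Fin 3) E) : Matrix (Fin 3) (Fin 3) E) = !![(τ 0 : E), 0, 0; 0, τ 1, 0; 0, 0, τ 2])
    (h01 : (τ 0 : E) ≠ τ 1) (h02 : (τ 0 : E) ≠ τ 2) (n₀ : rationalUnipotent F E c 3) :
    ∃ η : rationalUnipotent F E c 3,
      (((η : adelicUnipotent F E c 3) : (quasiSplit F E c 3).Adelic))⁻¹ *
          ((t : torusAdelic F E c 3) : (quasiSplit F E c 3).Adelic) *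
          ((η : adelicUnipotent F E c 3) : (quasiSplit F E c 3).Adelic) =
        ((t : torusAdelic F E c 3) : (quasiSplit F E c 3).Adelic) *
          ((n₀ : adelicUnipotent F E c 3) : (quasiSplit F E c 3).Adelic) := by
  -- the rational matrix of `n₀`
  obtain ⟨gn, hgn⟩ := n₀.2
  have hgn' : (((⟨((n₀ : adelicUnipotent F E c 3) : (quasiSplit F E c 3).Adelic), ⟨gn, hgn⟩⟩ :
      (quasiSplit F E c 3).arithmeticSubgroup)) : (quasiSplit F E c 3).Adelic) = (quasiSplit F E c 3).toAdelic gn :=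
    hgn.symm
  obtain ⟨hnB, hnd⟩ := (coe_mem_adelicUnipotent_iff_of_eq_toAdelic hgn').1 (n₀ : adelicUnipotent F E c 3).2
  -- `β := g · gn` is upper triangular with diagonal `τ`
  set M : Matrix (Fin 3) (Fin 3) E := ((gn.val : GL (Fin 3) E) : Matrix (Fin 3) (Fin 3) E) with hM
  have hβ : (((g * gn).val : GL (Fin 3) E) : Matrix (Fin 3) (Fin 3) E) =
      !![(τ 0 : E), τ 0 * M 0 1, τ 0 * M 0 2; 0, τ 1, τ 1 * M 1 2; 0, 0, τ 2] := by
    have h10 : M 1 0 = 0 := hnB (by decide)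
    have h20 : M 2 0 = 0 := hnB (by decide)
    have h21 : M 2 1 = 0 := hnB (by decide)
    have h00 : M 0 0 = 1 := hnd 0
    have h11 : M 1 1 = 1 := hnd 1
    have h22 : M 2 2 = 1 := hnd 2
    rw [coe_val_mul₁₃, hgmat, ← hM]
    ext i j
    fin_cases i <;> fin_cases j <;>
      simp [Matrix.mul_apply, Fin.sum_univ_three, h10, h20, h21, h00, h11, h22]
  -- step 1 and step 2
  obtain ⟨u₁, hu₁, z₁, hz₁⟩ := exists_unipotent_conj_eq_corner hc hβ h01
  obtain ⟨u₂, hu₂, hdiag⟩ := exists_unipotent_conj_eq_diagonal_of_corner hz₁ h02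
  -- `u := u₂ u₁ ∈ N(F)` conjugates `β` to `g`
  have hu : ((u₂ * u₁).val : GL (Fin 3) E) ∈ unipotentOfForm (c : E →+* E) 3 := Subgroup.mul_mem _ hu₂ hu₁
  have hconj : (u₂ * u₁) * (g * gn) * (u₂ * u₁)⁻¹ = g := by
    have e : (u₂ * u₁) * (g * gn) * (u₂ * u₁)⁻¹ = u₂ * (u₁ * (g * gn) * u₁⁻¹) * u₂⁻¹ := by group
    rw [e]
    exact Subtype.ext (Units.ext (by rw [hdiag, hgmat]))
  -- the rational unipotent `η := ι(u₂ u₁)`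
  have hηU : (quasiSplit F E c 3).toAdelic (u₂ * u₁) ∈ adelicUnipotent F E c 3 := by
    have hγ : (((⟨(quasiSplit F E c 3).toAdelic (u₂ * u₁), ⟨u₂ * u₁, rfl⟩⟩ :
        (quasiSplit F E c 3).arithmeticSubgroup)) : (quasiSplit F E c 3).Adelic) =
          (quasiSplit F E c 3).toAdelic (u₂ * u₁) := rfl
    obtain ⟨hB', hd'⟩ := (mem_upperUnitriangular_iff _).1 (mem_unipotentOfForm_iff.1 hu).2
    exact (coe_mem_adelicUnipotent_iff_of_eq_toAdelic hγ).2 ⟨hB', hd'⟩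
  have hB' : g * gn = (u₂ * u₁)⁻¹ * ((u₂ * u₁) * (g * gn) * (u₂ * u₁)⁻¹) * (u₂ * u₁) := by group
  rw [hconj] at hB'
  refine ⟨⟨⟨(quasiSplit F E c 3).toAdelic (u₂ * u₁), hηU⟩, ⟨u₂ * u₁, rfl⟩⟩, ?_⟩
  have hn₀ : ((n₀ : adelicUnipotent F E c 3) : (quasiSplit F E c 3).Adelic) = (quasiSplit F E c 3).toAdelic gn :=
    hgn.symm
  rw [hn₀, hg]
  change ((quasiSplit F E c 3).toAdelic (u₂ * u₁))⁻¹ * (quasiSplit F E c 3).toAdelic g *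
      (quasiSplit F E c 3).toAdelic (u₂ * u₁) =
    (quasiSplit F E c 3).toAdelic g * (quasiSplit F E c 3).toAdelic gn
  rw [← map_mul, ← map_inv, ← map_mul, ← map_mul, hB']

/-- **Uniqueness of the conjugator**: for `t = ι(d(τ))` with pairwise distinct `τ`, if `η⁻¹ t η = η′⁻¹ t η′` with
`η, η′ ∈ N(F)` then `η = η′` — `η η′⁻¹` commutes with `t`, so is diagonal (★ `offDiag_eq_zero_of_commute_diagonal`)
and unipotent, hence trivial. [cite: Rogawski1990, §3.6 (p. 27)] [cite: Arthur1978TraceFormulaI, §8] -/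
theorem rationalUnipotent_eq_of_inv_mul_mul_eq {t : rationalTorus F E c 3}
    {g : (quasiSplit F E c 3).Rational} {τ : Fin 3 → Eˣ}
    (hg : ((t : torusAdelic F E c 3) : (quasiSplit F E c 3).Adelic) = (quasiSplit F E c 3).toAdelic g)
    (hgmat : ((g.val : GL (Fin 3) E) : Matrix (Fin 3) (Fin 3) E) = !![(τ 0 : E), 0, 0; 0, τ 1, 0; 0, 0, τ 2])
    (h01 : (τ 0 : E) ≠ τ 1) (h02 : (τ 0 : E) ≠ τ 2) (h12 : (τ 1 : E) ≠ τ 2) {η η' : rationalUnipotent F E c 3}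
    (h : (((η : adelicUnipotent F E c 3) : (quasiSplit F E c 3).Adelic))⁻¹ *
          ((t : torusAdelic F E c 3) : (quasiSplit F E c 3).Adelic) *
          ((η : adelicUnipotent F E c 3) : (quasiSplit F E c 3).Adelic) =
        (((η' : adelicUnipotent F E c 3) : (quasiSplit F E c 3).Adelic))⁻¹ *
          ((t : torusAdelic F E c 3) : (quasiSplit F E c 3).Adelic) *
          ((η' : adelicUnipotent F E c 3) : (quasiSplit F E c 3).Adelic)) :
    η = η' := by
  -- the elements of `G(F)` involved
  set γt : (quasiSplit F E c 3).arithmeticSubgroup := ⟨((t : torusAdelic F E c 3) : (quasiSplit F E c 3).Adelic), t.2⟩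
    with hγt
  set γη : (quasiSplit F E c 3).arithmeticSubgroup :=
    ⟨((η : adelicUnipotent F E c 3) : (quasiSplit F E c 3).Adelic), η.2⟩ with hγη
  set γη' : (quasiSplit F E c 3).arithmeticSubgroup :=
    ⟨((η' : adelicUnipotent F E c 3) : (quasiSplit F E c 3).Adelic), η'.2⟩ with hγη'
  obtain ⟨gδ, hgδ⟩ := exists_coe_eq_toAdelic (γη * γη'⁻¹)
  -- `δ := η η'⁻¹` commutes with `t`
  have hcomm : (γη * γη'⁻¹) * γt = γt * (γη * γη'⁻¹) := by
    apply Subtype.ext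
    change ((η : adelicUnipotent F E c 3) : (quasiSplit F E c 3).Adelic) *
        (((η' : adelicUnipotent F E c 3) : (quasiSplit F E c 3).Adelic))⁻¹ *
        ((t : torusAdelic F E c 3) : (quasiSplit F E c 3).Adelic) =
      ((t : torusAdelic F E c 3) : (quasiSplit F E c 3).Adelic) *
        (((η : adelicUnipotent F E c 3) : (quasiSplit F E c 3).Adelic) *
          (((η' : adelicUnipotent F E c 3) : (quasiSplit F E c 3).Adelic))⁻¹)
    symm
    calc ((t : torusAdelic F E c 3) : (quasiSplit F E c 3).Adelic) *
          (((η : adelicUnipotent F E c 3) : (quasiSplit F E c 3).Adelic) *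
            (((η' : adelicUnipotent F E c 3) : (quasiSplit F E c 3).Adelic))⁻¹)
        = ((η : adelicUnipotent F E c 3) : (quasiSplit F E c 3).Adelic) *
            ((((η : adelicUnipotent F E c 3) : (quasiSplit F E c 3).Adelic))⁻¹ *
              ((t : torusAdelic F E c 3) : (quasiSplit F E c 3).Adelic) *
              ((η : adelicUnipotent F E c 3) : (quasiSplit F E c 3).Adelic)) *
            (((η' : adelicUnipotent F E c 3) : (quasiSplit F E c 3).Adelic))⁻¹ := by group
      _ = ((η : adelicUnipotent F E c 3) : (quasiSplit F E c 3).Adelic) *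
            ((((η' : adelicUnipotent F E c 3) : (quasiSplit F E c 3).Adelic))⁻¹ *
              ((t : torusAdelic F E c 3) : (quasiSplit F E c 3).Adelic) *
              ((η' : adelicUnipotent F E c 3) : (quasiSplit F E c 3).Adelic)) *
            (((η' : adelicUnipotent F E c 3) : (quasiSplit F E c 3).Adelic))⁻¹ := by rw [h]
      _ = ((η : adelicUnipotent F E c 3) : (quasiSplit F E c 3).Adelic) *
            (((η' : adelicUnipotent F E c 3) : (quasiSplit F E c 3).Adelic))⁻¹ *
            ((t : torusAdelic F E c 3) : (quasiSplit F E c 3).Adelic) := by group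
  have hmat := (commute_iff_of_eq_toAdelic hgδ (show (γt : (quasiSplit F E c 3).Adelic) = _ from hg)).1 hcomm
  rw [hgmat] at hmat
  obtain ⟨e01, e02, e10, e12, e20, e21⟩ := offDiag_eq_zero_of_commute_diagonal h01 h02 h12 hmat
  -- `δ` is unipotent
  have hδU : ((γη * γη'⁻¹ : (quasiSplit F E c 3).arithmeticSubgroup) : (quasiSplit F E c 3).Adelic) ∈
      adelicUnipotent F E c 3 := by
    rw [Subgroup.coe_mul, Subgroup.coe_inv]
    exact Subgroup.mul_mem _ (η : adelicUnipotent F E c 3).2 (Subgroup.inv_mem _ (η' : adelicUnipotent F E c 3).2)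
  obtain ⟨-, hdd⟩ := (coe_mem_adelicUnipotent_iff_of_eq_toAdelic hgδ).1 hδU
  -- so `gδ = 1`
  have hone : ((gδ.val : GL (Fin 3) E) : Matrix (Fin 3) (Fin 3) E) =
      (((1 : (quasiSplit F E c 3).Rational).val : GL (Fin 3) E) : Matrix (Fin 3) (Fin 3) E) := by
    have h00 := hdd 0
    have h11 := hdd 1
    have h22 := hdd 2
    change _ = ((1 : GL (Fin 3) E) : Matrix (Fin 3) (Fin 3) E)
    ext i j
    fin_cases i <;> fin_cases j <;> simp [Units.val_one, e01, e02, e10, e12, e20, e21, h00, h11, h22]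
  have hδ1 : γη * γη'⁻¹ = 1 :=
    (eq_iff_val_eq_of_eq_toAdelic hgδ (show ((1 : (quasiSplit F E c 3).arithmeticSubgroup) :
      (quasiSplit F E c 3).Adelic) = (quasiSplit F E c 3).toAdelic 1 by rw [map_one]; rfl)).2 hone
  have hγ : γη = γη' := mul_inv_eq_one.1 hδ1
  apply Subtype.ext
  apply Subtype.ext
  exact congrArg (fun z : (quasiSplit F E c 3).arithmeticSubgroup => (z : (quasiSplit F E c 3).Adelic)) hγ

/-- `t⁻¹ η⁻¹ t η ∈ N(𝔸_F)` for `t ∈ T(𝔸_F)`, `η ∈ N(𝔸_F)` (`B(𝔸_F)` normalises `N(𝔸_F)`, ★ `conj_mem_adelicUnipotent`).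
[cite: Rogawski1990, §1.10] -/
theorem torus_inv_mul_inv_mul_mul_mem_adelicUnipotent {t : (quasiSplit F E c 3).Adelic}
    (ht : t ∈ torusAdelic F E c 3) (η : adelicUnipotent F E c 3) :
    t⁻¹ * ((η : (quasiSplit F E c 3).Adelic))⁻¹ * t * (η : (quasiSplit F E c 3).Adelic) ∈ adelicUnipotent F E c 3 := by
  have h1 : t⁻¹ * ((η : (quasiSplit F E c 3).Adelic))⁻¹ * t ∈ adelicUnipotent F E c 3 := by
    have h := conj_mem_adelicUnipotent (torusAdelic_le_borelAdelic ht) (Subgroup.inv_mem _ η.2)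
    simpa only [mul_assoc] using h
  exact Subgroup.mul_mem _ h1 η.2

/-- **THE RATIONAL TWIST IS A BIJECTION OF `N(F)`** for an `N`-regular rational torus point `t = ι(d(τ))`
(`τ₀ ≠ τ₁`, `τ₀ ≠ τ₂`, and the unitarity relations): there is `e : N(F) ≃ N(F)` with `t · e(η) = η⁻¹ t η` for all
`η ∈ N(F)` (`e(η) = t⁻¹η⁻¹tη`; surjective by `exists_rationalUnipotent_inv_mul_mul_eq`, injective by
`rationalUnipotent_eq_of_inv_mul_mul_eq`) — Arthur's parametrisation of `(γN)(F)` by `N(F)` for an unramified class.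
[cite: Arthur1978TraceFormulaI, §8] [cite: Rogawski1990, §7.3 (p. 97)] -/
theorem exists_equiv_rationalUnipotent_twist (hc : c * c = 1) {t : rationalTorus F E c 3}
    {g : (quasiSplit F E c 3).Rational} {τ : Fin 3 → Eˣ}
    (hg : ((t : torusAdelic F E c 3) : (quasiSplit F E c 3).Adelic) = (quasiSplit F E c 3).toAdelic g)
    (hgmat : ((g.val : GL (Fin 3) E) : Matrix (Fin 3) (Fin 3) E) = !![(τ 0 : E), 0, 0; 0, τ 1, 0; 0, 0, τ 2])
    (h01 : (τ 0 : E) ≠ τ 1) (h02 : (τ 0 : E) ≠ τ 2) (h12 : (τ 1 : E) ≠ τ 2) :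
    ∃ e : rationalUnipotent F E c 3 ≃ rationalUnipotent F E c 3, ∀ η : rationalUnipotent F E c 3,
      ((t : torusAdelic F E c 3) : (quasiSplit F E c 3).Adelic) *
          ((e η : adelicUnipotent F E c 3) : (quasiSplit F E c 3).Adelic) =
        (((η : adelicUnipotent F E c 3) : (quasiSplit F E c 3).Adelic))⁻¹ *
          ((t : torusAdelic F E c 3) : (quasiSplit F E c 3).Adelic) *
          ((η : adelicUnipotent F E c 3) : (quasiSplit F E c 3).Adelic) := by
  set tG : (quasiSplit F E c 3).Adelic := ((t : torusAdelic F E c 3) : (quasiSplit F E c 3).Adelic) with htG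
  -- the twist map on `N(F)`
  have hmemU : ∀ η : rationalUnipotent F E c 3,
      tG⁻¹ * (((η : adelicUnipotent F E c 3) : (quasiSplit F E c 3).Adelic))⁻¹ * tG *
        ((η : adelicUnipotent F E c 3) : (quasiSplit F E c 3).Adelic) ∈ adelicUnipotent F E c 3 := fun η =>
    torus_inv_mul_inv_mul_mul_mem_adelicUnipotent (t : torusAdelic F E c 3).2 _
  have hmemQ : ∀ η : rationalUnipotent F E c 3,
      tG⁻¹ * (((η : adelicUnipotent F E c 3) : (quasiSplit F E c 3).Adelic))⁻¹ * tG *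
        ((η : adelicUnipotent F E c 3) : (quasiSplit F E c 3).Adelic) ∈ (quasiSplit F E c 3).arithmeticSubgroup :=
    fun η => Subgroup.mul_mem _ (Subgroup.mul_mem _ (Subgroup.mul_mem _ (Subgroup.inv_mem _ t.2)
      (Subgroup.inv_mem _ η.2)) t.2) η.2
  let twist : rationalUnipotent F E c 3 → rationalUnipotent F E c 3 := fun η =>
    ⟨⟨_, hmemU η⟩, hmemQ η⟩
  have htwist : ∀ η : rationalUnipotent F E c 3,
      ((twist η : adelicUnipotent F E c 3) : (quasiSplit F E c 3).Adelic) =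
        tG⁻¹ * (((η : adelicUnipotent F E c 3) : (quasiSplit F E c 3).Adelic))⁻¹ * tG *
          ((η : adelicUnipotent F E c 3) : (quasiSplit F E c 3).Adelic) := fun η => rfl
  have hkey : ∀ η : rationalUnipotent F E c 3,
      tG * ((twist η : adelicUnipotent F E c 3) : (quasiSplit F E c 3).Adelic) =
        (((η : adelicUnipotent F E c 3) : (quasiSplit F E c 3).Adelic))⁻¹ * tG *
          ((η : adelicUnipotent F E c 3) : (quasiSplit F E c 3).Adelic) := by
    intro η
    rw [htwist]
    group
  have hbij : Function.Bijective twist := by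
    constructor
    · intro η η' hηη'
      have h := congrArg (fun z : rationalUnipotent F E c 3 =>
        tG * ((z : adelicUnipotent F E c 3) : (quasiSplit F E c 3).Adelic)) hηη'
      simp only [hkey] at h
      exact rationalUnipotent_eq_of_inv_mul_mul_eq hg hgmat h01 h02 h12 h
    · intro n₀
      obtain ⟨η, hη⟩ := exists_rationalUnipotent_inv_mul_mul_eq hc hg hgmat h01 h02 n₀
      refine ⟨η, Subtype.ext (Subtype.ext ?_)⟩
      have h := hkey η
      rw [hη] at h
      exact mul_left_cancel h
  exact ⟨Equiv.ofBijective twist hbij, fun η => hkey η⟩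

end Twist

/-! ## §3 The global Jacobian of the twist is `1` for a RATIONAL regular torus point -/

section Jacobian

/-- **The twist data of an `N`-regular RATIONAL torus point are PRINCIPAL**: for `t = ι(d(τ)) ∈ T(F)` with
`diagUnit t 0 ≠ diagUnit t 1`, `diagUnit t 0 ≠ diagUnit t 2` the units `l₁ = 1 − d₀⁻¹d₁`, `l₂ = 1 − d₀⁻¹d₂` of ★
W0 (II)∕(III) are the principal idèles `(1 − τ₀⁻¹τ₁)_𝔸`, `(1 − τ₀⁻¹τ₂)_𝔸`, the latter `c`-fixed
(`c(τ₀⁻¹τ₂) = τ₀⁻¹τ₂` by the unitarity relations). [cite: Rogawski1990, §7.3 (p. 97)] [cite: TateThesis1967, Thm. 4.3.1] -/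
theorem exists_twist_units_of_rationalTorus (t : rationalTorus F E c 3)
    (h01 : diagUnit (torusAdelic_le_borelAdelic (t : torusAdelic F E c 3).2) 0 ≠
      diagUnit (torusAdelic_le_borelAdelic (t : torusAdelic F E c 3).2) 1)
    (h02 : diagUnit (torusAdelic_le_borelAdelic (t : torusAdelic F E c 3).2) 0 ≠
      diagUnit (torusAdelic_le_borelAdelic (t : torusAdelic F E c 3).2) 2) :
    ∃ (l₁ l₂ : (AdeleRing (𝓞 E) E)ˣ),
      (l₁ : AdeleRing (𝓞 E) E) = 1 - (((diagUnit (torusAdelic_le_borelAdelic (t : torusAdelic F E c 3).2) 0)⁻¹ *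
        diagUnit (torusAdelic_le_borelAdelic (t : torusAdelic F E c 3).2) 1 : (AdeleRing (𝓞 E) E)ˣ) : AdeleRing (𝓞 E) E) ∧
      (l₂ : AdeleRing (𝓞 E) E) = 1 - (((diagUnit (torusAdelic_le_borelAdelic (t : torusAdelic F E c 3).2) 0)⁻¹ *
        diagUnit (torusAdelic_le_borelAdelic (t : torusAdelic F E c 3).2) 2 : (AdeleRing (𝓞 E) E)ˣ) : AdeleRing (𝓞 E) E) ∧
      conjAdele F E c (l₂ : AdeleRing (𝓞 E) E) = l₂ ∧
      l₁ ∈ GaloisRepresentations.principalIdeles E ∧ l₂ ∈ GaloisRepresentations.principalIdeles E := by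
  obtain ⟨g, τ, hg, hgmat, ⟨hr0, hr1, hr2⟩, hτ⟩ := exists_rational_diagonal_of_rationalTorus t
  have hτ01 : (τ 0 : E) ≠ τ 1 := ne_of_diagUnit_ne hτ h01
  have hτ02 : (τ 0 : E) ≠ τ 2 := ne_of_diagUnit_ne hτ h02
  set φE : E →* AdeleRing (𝓞 E) E := (algebraMap E (AdeleRing (𝓞 E) E) : E →* AdeleRing (𝓞 E) E) with hφE
  have hne1 : (1 : E) - (τ 0 : E)⁻¹ * τ 1 ≠ 0 := by
    intro h
    apply hτ01
    have h' : (τ 0 : E)⁻¹ * τ 1 = 1 := by linear_combination -h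
    have := congrArg (fun z => (τ 0 : E) * z) h'
    simpa [← mul_assoc, mul_inv_cancel₀ (τ 0).ne_zero] using this.symm
  have hne2 : (1 : E) - (τ 0 : E)⁻¹ * τ 2 ≠ 0 := by
    intro h
    apply hτ02
    have h' : (τ 0 : E)⁻¹ * τ 2 = 1 := by linear_combination -h
    have := congrArg (fun z => (τ 0 : E) * z) h'
    simpa [← mul_assoc, mul_inv_cancel₀ (τ 0).ne_zero] using this.symm
  -- `d₀⁻¹ dᵢ = (τ₀⁻¹ τᵢ)_𝔸`
  have hquot : ∀ i, (((diagUnit (torusAdelic_le_borelAdelic (t : torusAdelic F E c 3).2) 0)⁻¹ *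
      diagUnit (torusAdelic_le_borelAdelic (t : torusAdelic F E c 3).2) i : (AdeleRing (𝓞 E) E)ˣ) : AdeleRing (𝓞 E) E) =
      algebraMap E (AdeleRing (𝓞 E) E) ((τ 0 : E)⁻¹ * τ i) := by
    intro i
    rw [hτ 0, hτ i, ← map_inv, ← map_mul, Units.coe_map, MonoidHom.coe_coe, Units.val_mul, Units.val_inv_eq_inv_val]
  refine ⟨Units.map φE (Units.mk0 _ hne1), Units.map φE (Units.mk0 _ hne2), ?_, ?_, ?_, ⟨_, rfl⟩, ⟨_, rfl⟩⟩
  · rw [hquot 1, Units.coe_map, MonoidHom.coe_coe, Units.val_mk0, map_sub, map_one]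
  · rw [hquot 2, Units.coe_map, MonoidHom.coe_coe, Units.val_mk0, map_sub, map_one]
  · -- `c(1 − τ₀⁻¹τ₂) = 1 − τ₀⁻¹τ₂`: `c τ₀ = τ₂⁻¹`, `c τ₂ = τ₀⁻¹`
    rw [Units.coe_map, MonoidHom.coe_coe, Units.val_mk0, ← algebraMap_conj]
    congr 1
    have hcτ0 : c (τ 0 : E) = (τ 2 : E)⁻¹ := eq_inv_of_mul_eq_one_left hr2
    have hcτ2 : c (τ 2 : E) = (τ 0 : E)⁻¹ := eq_inv_of_mul_eq_one_left hr0
    change c (1 - (τ 0 : E)⁻¹ * τ 2) = 1 - (τ 0 : E)⁻¹ * τ 2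
    rw [map_sub, map_one, map_mul, map_inv₀, hcτ0, hcτ2, inv_inv, mul_comm]

variable [MeasurableSpace (adelicUnipotent F E c 3)] [BorelSpace (adelicUnipotent F E c 3)]

/-- **GLOBAL JACOBIAN ONE — `∫_{N(𝔸_F)} φ(u⁻¹ t u) dν(u) = ∫_{N(𝔸_F)} φ(t u) dν(u)`** for every Haar measure `ν`
of `N(𝔸_F)`, every `N`-REGULAR RATIONAL torus point `t ∈ T(F)` (`diagUnit t 0 ≠ diagUnit t 1, diagUnit t 2`) and
every `φ : G(𝔸_F) → V`: ★ W0 (III) `integral_adelicUnipotent_inv_mul_mul_eq_smul` with the constant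
`(‖l₁‖_𝔸 · χ⁻(l₂))⁻¹ = 1` by the product formula (★ `AdeleRing.distribHaarChar_principalIdeles`, ★
`traceZeroModulus_eq_sqrt`) — Arthur's change of variables `n ↦ γ⁻¹n⁻¹γn` on `N(𝔸)` for a rational unramified
`γ` has Jacobian `1`. [cite: Arthur1978TraceFormulaI, §8] [cite: Rogawski1990, §7.3 (p. 97)] [cite: TateThesis1967, Thm. 4.3.1] -/
theorem integral_adelicUnipotent_inv_mul_mul_eq_of_rationalTorus (hc : c * c = 1) (hc1 : c ≠ 1)
    (ν : Measure (adelicUnipotent F E c 3)) [ν.IsHaarMeasure] (t : rationalTorus F E c 3)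
    (h01 : diagUnit (torusAdelic_le_borelAdelic (t : torusAdelic F E c 3).2) 0 ≠
      diagUnit (torusAdelic_le_borelAdelic (t : torusAdelic F E c 3).2) 1)
    (h02 : diagUnit (torusAdelic_le_borelAdelic (t : torusAdelic F E c 3).2) 0 ≠
      diagUnit (torusAdelic_le_borelAdelic (t : torusAdelic F E c 3).2) 2)
    {V : Type*} [NormedAddCommGroup V] [NormedSpace ℝ V] (φ : (quasiSplit F E c 3).Adelic → V) :
    ∫ u : adelicUnipotent F E c 3,
        φ (((u : (quasiSplit F E c 3).Adelic))⁻¹ * ((t : torusAdelic F E c 3) : (quasiSplit F E c 3).Adelic) *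
          (u : (quasiSplit F E c 3).Adelic)) ∂ν =
      ∫ u : adelicUnipotent F E c 3,
        φ (((t : torusAdelic F E c 3) : (quasiSplit F E c 3).Adelic) * (u : (quasiSplit F E c 3).Adelic)) ∂ν := by
  haveI : LocallyCompactSpace (AdeleRing (𝓞 E) E) := locallyCompactSpace_adeleRing' E
  letI : MeasurableSpace (AdeleRing (𝓞 E) E) := borel _
  haveI : BorelSpace (AdeleRing (𝓞 E) E) := ⟨rfl⟩
  obtain ⟨l₁, l₂, hl₁, hl₂, hl₂c, hp₁, hp₂⟩ := exists_twist_units_of_rationalTorus t h01 h02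
  obtain ⟨δ, hδ⟩ := exists_conjAdele_eq_neg (F := F) (E := E) hc hc1
  set tB : torusInBorel F E c 3 :=
    ⟨⟨((t : torusAdelic F E c 3) : (quasiSplit F E c 3).Adelic), torusAdelic_le_borelAdelic (t : torusAdelic F E c 3).2⟩,
      (mem_torusInBorel_iff _).2 (t : torusAdelic F E c 3).2⟩ with htB
  have hd := glDiagonal_diagUnit_torus tB
  have h := integral_adelicUnipotent_inv_mul_mul_eq_smul hc ν tB hd hl₁ hl₂ hl₂c φ
  have hk1 : distribHaarChar (AdeleRing (𝓞 E) E) l₁ = 1 := AdeleRing.distribHaarChar_principalIdeles E hp₁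
  have hk2 : traceZeroModulus l₂ hl₂c = 1 := by
    rw [traceZeroModulus_eq_sqrt hc δ hδ l₂ hl₂c, AdeleRing.distribHaarChar_principalIdeles E hp₂, NNReal.sqrt_one]
  rw [hk1, hk2, inv_one, mul_one, NNReal.coe_one, one_smul] at h
  exact h

/-- `u ↦ φ(u⁻¹ t u)` is `ν`-integrable iff `u ↦ φ(t u)` is, for an `N`-regular rational torus point (★
`integrable_adelicUnipotent_inv_mul_mul_iff`). [cite: Rogawski1990, §7.3 (p. 97)] -/
theorem integrable_adelicUnipotent_inv_mul_mul_iff_of_rationalTorus (hc : c * c = 1)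
    (ν : Measure (adelicUnipotent F E c 3)) [ν.IsHaarMeasure] (t : rationalTorus F E c 3)
    (h01 : diagUnit (torusAdelic_le_borelAdelic (t : torusAdelic F E c 3).2) 0 ≠
      diagUnit (torusAdelic_le_borelAdelic (t : torusAdelic F E c 3).2) 1)
    (h02 : diagUnit (torusAdelic_le_borelAdelic (t : torusAdelic F E c 3).2) 0 ≠
      diagUnit (torusAdelic_le_borelAdelic (t : torusAdelic F E c 3).2) 2)
    {V : Type*} [NormedAddCommGroup V] (φ : (quasiSplit F E c 3).Adelic → V) :
    Integrable (fun u : adelicUnipotent F E c 3 =>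
        φ (((u : (quasiSplit F E c 3).Adelic))⁻¹ * ((t : torusAdelic F E c 3) : (quasiSplit F E c 3).Adelic) *
          (u : (quasiSplit F E c 3).Adelic))) ν ↔
      Integrable (fun u : adelicUnipotent F E c 3 =>
        φ (((t : torusAdelic F E c 3) : (quasiSplit F E c 3).Adelic) * (u : (quasiSplit F E c 3).Adelic))) ν := by
  haveI : LocallyCompactSpace (AdeleRing (𝓞 E) E) := locallyCompactSpace_adeleRing' E
  letI : MeasurableSpace (AdeleRing (𝓞 E) E) := borel _
  haveI : BorelSpace (AdeleRing (𝓞 E) E) := ⟨rfl⟩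
  obtain ⟨l₁, l₂, hl₁, hl₂, hl₂c, -, -⟩ := exists_twist_units_of_rationalTorus t h01 h02
  set tB : torusInBorel F E c 3 :=
    ⟨⟨((t : torusAdelic F E c 3) : (quasiSplit F E c 3).Adelic), torusAdelic_le_borelAdelic (t : torusAdelic F E c 3).2⟩,
      (mem_torusInBorel_iff _).2 (t : torusAdelic F E c 3).2⟩ with htB
  exact integrable_adelicUnipotent_inv_mul_mul_iff hc ν tB (glDiagonal_diagUnit_torus tB) hl₁ hl₂ hl₂c φ

end Jacobian

/-! ## §4 THE UNFOLDING of the class Borel lattice sum over `N(F)\N(𝔸_F)` -/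

section Unfold

variable [MeasurableSpace (adelicUnipotent F E c 3)] [BorelSpace (adelicUnipotent F E c 3)]

/-- **The fibration of the class Borel lattice sum** (private packaging of the data of §4): for an `N`-regular
class there is a family `Ψ_t(u) = ψ(u⁻¹ t u)` on `N(𝔸_F)`, indexed by the rational torus points `t` of the class,
with `Σ_{β ∈ B(F)∩𝔬̲} ψ(n⁻¹βn) = Σ_{(t,η) ∈ (T(F)∩𝔬̲) × N(F)} Ψ_t(η n)` pointwise, each `Ψ_t` integrable, finite total
mass, and `∫ Ψ_t = ∫ ψ(t u) du` (§2 + §3). [cite: Arthur1978TraceFormulaI, §8] [cite: Rogawski1990, §7.3 (p. 97)] -/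
private theorem exists_latticeSum_fibration (hc : c * c = 1) (hc1 : c ≠ 1)
    {cl : (quasiSplit F E c 3).arithmeticSubgroup → ι} (hclN : IsUnipotentInvariantOnBorel F E c 3 cl) (i : ι)
    (hreg : ∀ β : arithmeticBorel F E c 3, cl β = i →
      diagUnit ((mem_arithmeticBorel_iff _).1 β.2) 0 ≠ diagUnit ((mem_arithmeticBorel_iff _).1 β.2) 1 ∧
      diagUnit ((mem_arithmeticBorel_iff _).1 β.2) 0 ≠ diagUnit ((mem_arithmeticBorel_iff _).1 β.2) 2)
    (ν : Measure (adelicUnipotent F E c 3)) [ν.IsHaarMeasure]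
    {ψ : (quasiSplit F E c 3).Adelic → ℂ} (hψc : Continuous ψ) (hψ : HasCompactSupport ψ) :
    ∃ Ψ : {t : rationalTorus F E c 3 //
        cl ⟨((t : torusAdelic F E c 3) : (quasiSplit F E c 3).Adelic), t.2⟩ = i} → adelicUnipotent F E c 3 → ℂ,
      (∀ n : adelicUnipotent F E c 3,
        borelSumClass cl i ψ ((n : adelicUnipotent F E c 3) : (quasiSplit F E c 3).Adelic)
            ((n : adelicUnipotent F E c 3) : (quasiSplit F E c 3).Adelic) =
          ∑' p : {t : rationalTorus F E c 3 //
              cl ⟨((t : torusAdelic F E c 3) : (quasiSplit F E c 3).Adelic), t.2⟩ = i} × rationalUnipotent F E c 3,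
            Ψ p.1 (p.2 • n)) ∧
      (∀ t, Continuous (Ψ t)) ∧ (∀ t, Integrable (Ψ t) ν) ∧ (∑' t, ∫⁻ u, ‖Ψ t u‖ₑ ∂ν ≠ ⊤) ∧
      ∀ t, ∫ u, Ψ t u ∂ν = ∫ m : adelicUnipotent F E c 3,
          ψ ((((t : rationalTorus F E c 3) : torusAdelic F E c 3) : (quasiSplit F E c 3).Adelic) *
            ((m : adelicUnipotent F E c 3) : (quasiSplit F E c 3).Adelic)) ∂ν := by
  classical
  -- regularity of the torus points of the class
  have hregT : ∀ t : {t : rationalTorus F E c 3 //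
      cl ⟨((t : torusAdelic F E c 3) : (quasiSplit F E c 3).Adelic), t.2⟩ = i},
      diagUnit (torusAdelic_le_borelAdelic ((t : rationalTorus F E c 3) : torusAdelic F E c 3).2) 0 ≠
        diagUnit (torusAdelic_le_borelAdelic ((t : rationalTorus F E c 3) : torusAdelic F E c 3).2) 1 ∧
      diagUnit (torusAdelic_le_borelAdelic ((t : rationalTorus F E c 3) : torusAdelic F E c 3).2) 0 ≠
        diagUnit (torusAdelic_le_borelAdelic ((t : rationalTorus F E c 3) : torusAdelic F E c 3).2) 2 := fun t =>
    hreg ⟨⟨(((t : rationalTorus F E c 3) : torusAdelic F E c 3) : (quasiSplit F E c 3).Adelic), t.1.2⟩,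
      (mem_arithmeticBorel_iff _).2 (torusAdelic_le_borelAdelic ((t : rationalTorus F E c 3) : torusAdelic F E c 3).2)⟩ t.2
  -- the twist equivalences, class point by class point
  have htw : ∀ t : {t : rationalTorus F E c 3 //
      cl ⟨((t : torusAdelic F E c 3) : (quasiSplit F E c 3).Adelic), t.2⟩ = i},
      ∃ e : rationalUnipotent F E c 3 ≃ rationalUnipotent F E c 3, ∀ η : rationalUnipotent F E c 3,
        (((t : rationalTorus F E c 3) : torusAdelic F E c 3) : (quasiSplit F E c 3).Adelic) *
            ((e η : adelicUnipotent F E c 3) : (quasiSplit F E c 3).Adelic) =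
          (((η : adelicUnipotent F E c 3) : (quasiSplit F E c 3).Adelic))⁻¹ *
            (((t : rationalTorus F E c 3) : torusAdelic F E c 3) : (quasiSplit F E c 3).Adelic) *
            ((η : adelicUnipotent F E c 3) : (quasiSplit F E c 3).Adelic) := by
    intro t
    obtain ⟨g, τ, hg, hgmat, ⟨hr0, hr1, hr2⟩, hτ⟩ := exists_rational_diagonal_of_rationalTorus (t : rationalTorus F E c 3)
    have h01 := ne_of_diagUnit_ne hτ (hregT t).1
    have h02 := ne_of_diagUnit_ne hτ (hregT t).2
    exact exists_equiv_rationalUnipotent_twist hc hg hgmat h01 h02 (ne_one_two_of_ne_zero_one hr1 hr2 h01)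
  choose e he using htw
  -- the fibre integrands `Ψ_t(u) = ψ(u⁻¹ t u)`
  set Ψ : {t : rationalTorus F E c 3 //
      cl ⟨((t : torusAdelic F E c 3) : (quasiSplit F E c 3).Adelic), t.2⟩ = i} →
        adelicUnipotent F E c 3 → ℂ := fun t u =>
    ψ (((u : (quasiSplit F E c 3).Adelic))⁻¹ *
      (((t : rationalTorus F E c 3) : torusAdelic F E c 3) : (quasiSplit F E c 3).Adelic) *
      (u : (quasiSplit F E c 3).Adelic)) with hΨ
  -- pointwise: the class Borel sum at `(n, n)` is `Σ_{(t, η)} Ψ_t(η • n)`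
  obtain ⟨ecell, hecell⟩ := exists_equiv_borelClassCell_prod hclN i
  have hpt : ∀ n : adelicUnipotent F E c 3,
      borelSumClass cl i ψ ((n : adelicUnipotent F E c 3) : (quasiSplit F E c 3).Adelic)
          ((n : adelicUnipotent F E c 3) : (quasiSplit F E c 3).Adelic) =
        ∑' p : {t : rationalTorus F E c 3 //
            cl ⟨((t : torusAdelic F E c 3) : (quasiSplit F E c 3).Adelic), t.2⟩ = i} ×
              rationalUnipotent F E c 3, Ψ p.1 (p.2 • n) := by
    intro n
    rw [borelSumClass_def, ← ecell.symm.tsum_eq, ← (Equiv.prodCongrRight e).tsum_eq]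
    refine tsum_congr fun p => ?_
    rw [Equiv.prodCongrRight_apply, hecell, he]
    simp only [hΨ, Subgroup.smul_def, smul_eq_mul, Subgroup.coe_mul, _root_.mul_inv_rev, mul_assoc]
  -- continuity and integrability of each `Ψ_t` (through the Jacobian-one twist)
  have hΨc : ∀ t, Continuous (Ψ t) := fun t =>
    hψc.comp (((continuous_subtype_val.inv).mul continuous_const).mul continuous_subtype_val)
  have hΨi : ∀ t, Integrable (Ψ t) ν := by
    intro t
    have hcont : Continuous fun u : adelicUnipotent F E c 3 =>
        ψ ((((t : rationalTorus F E c 3) : torusAdelic F E c 3) : (quasiSplit F E c 3).Adelic) *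
          (u : (quasiSplit F E c 3).Adelic)) :=
      hψc.comp (continuous_const.mul continuous_subtype_val)
    have hsupp : HasCompactSupport fun u : adelicUnipotent F E c 3 =>
        ψ ((((t : rationalTorus F E c 3) : torusAdelic F E c 3) : (quasiSplit F E c 3).Adelic) *
          (u : (quasiSplit F E c 3).Adelic)) := by
      simpa only [mul_one] using hasCompactSupport_comp_mul_adelicUnipotent_mul hψ
        ((((t : rationalTorus F E c 3) : torusAdelic F E c 3) : (quasiSplit F E c 3).Adelic)) 1
    exact (integrable_adelicUnipotent_inv_mul_mul_iff_of_rationalTorus hc ν (t : rationalTorus F E c 3) (hregT t).1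
      (hregT t).2 ψ).2 (hcont.integrable_of_hasCompactSupport hsupp)
  -- only finitely many `t` meet the support: finite total mass
  have hS : {t : {t : rationalTorus F E c 3 //
      cl ⟨((t : torusAdelic F E c 3) : (quasiSplit F E c 3).Adelic), t.2⟩ = i} |
        ∃ u : adelicUnipotent F E c 3, Ψ t u ≠ 0}.Finite := by
    have h0 := (finite_setOf_rationalTorus_meets_support hψ 1 1).preimage
      (f := (Subtype.val : {t : rationalTorus F E c 3 //
        cl ⟨((t : torusAdelic F E c 3) : (quasiSplit F E c 3).Adelic), t.2⟩ = i} → rationalTorus F E c 3))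
      Subtype.val_injective.injOn
    refine h0.subset fun t ht => ?_
    obtain ⟨u, hu⟩ := ht
    refine ⟨⟨_, torus_inv_mul_inv_mul_mul_mem_adelicUnipotent ((t : rationalTorus F E c 3) : torusAdelic F E c 3).2 u⟩, ?_⟩
    rw [inv_one, one_mul, mul_one]
    have e : (((t : rationalTorus F E c 3) : torusAdelic F E c 3) : (quasiSplit F E c 3).Adelic) *
        ((((t : rationalTorus F E c 3) : torusAdelic F E c 3) : (quasiSplit F E c 3).Adelic)⁻¹ *
          ((u : (quasiSplit F E c 3).Adelic))⁻¹ *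
          (((t : rationalTorus F E c 3) : torusAdelic F E c 3) : (quasiSplit F E c 3).Adelic) * (u : (quasiSplit F E c 3).Adelic)) =
        ((u : (quasiSplit F E c 3).Adelic))⁻¹ *
          (((t : rationalTorus F E c 3) : torusAdelic F E c 3) : (quasiSplit F E c 3).Adelic) * (u : (quasiSplit F E c 3).Adelic) := by
      group
    rw [e]
    exact hu
  have hzero : ∀ t ∉ hS.toFinset, Ψ t = 0 := by
    intro t ht
    funext u
    by_contra h
    exact ht (hS.mem_toFinset.2 ⟨u, h⟩)
  have hfin : ∑' t, ∫⁻ u, ‖Ψ t u‖ₑ ∂ν ≠ ⊤ := by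
    rw [tsum_eq_sum (s := hS.toFinset) (fun t ht => by rw [hzero t ht]; simp)]
    exact ENNReal.sum_ne_top.2 fun t _ => (hΨi t).2.ne
  exact ⟨Ψ, hpt, hΨc, hΨi, hfin, fun t =>
    integral_adelicUnipotent_inv_mul_mul_eq_of_rationalTorus hc hc1 ν (t : rationalTorus F E c 3) (hregT t).1 (hregT t).2 ψ⟩

/-- Instances for the left translation action of `N(F)` on `N(𝔸_F)` (private plumbing): measurable, measure
preserving for a Haar measure. [folklore] -/
private theorem smul_instances (ν : Measure (adelicUnipotent F E c 3)) [ν.IsHaarMeasure] :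
    MeasurableConstSMul (rationalUnipotent F E c 3) (adelicUnipotent F E c 3) ∧
      SMulInvariantMeasure (rationalUnipotent F E c 3) (adelicUnipotent F E c 3) ν := by
  haveI : MeasurableConstSMul (rationalUnipotent F E c 3) (adelicUnipotent F E c 3) :=
    ⟨fun γ => (continuous_const.mul continuous_id).measurable⟩
  exact ⟨inferInstance, ⟨fun γ s _hs => by
    rw [show (fun u : adelicUnipotent F E c 3 => γ • u) ⁻¹' s =
        (fun u : adelicUnipotent F E c 3 => ((γ : adelicUnipotent F E c 3)) * u) ⁻¹' s from rfl,
      measure_preimage_mul]⟩⟩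

/-- **`∫_{N(F)\N(𝔸)} Σ_{β ∈ B(F)∩𝔬̲} ψ(n⁻¹βn) dn = Σ_{t ∈ T(F)∩𝔬̲} ∫_{N(𝔸)} ψ(t u) du` FOR AN `N`-REGULAR CLASS.**  For
`U(J₃)` of a quadratic `E/F` (`c² = 1`, `c ≠ 1`), a class map `cl` on `G(F)` constant along `N(F)` on `B(F)`
(★ `IsUnipotentInvariantOnBorel`), a class `𝔬 = i` ALL of whose rational Borel points have `N`-regular diagonal
(`hreg`), a Haar measure `ν` of `N(𝔸_F)`, a fundamental domain `Ω` of `N(F)` in `N(𝔸_F)` and `ψ ∈ C_c(G(𝔸_F))`: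
`∫_Ω Σ_{β ∈ B(F), cl β = i} ψ(n⁻¹ β n) dν(n) = Σ'_{t ∈ T(F), cl t = i} ∫_{N(𝔸_F)} ψ(t u) dν(u)` — the cell
`{β} ≃ {t} × N(F)` (★ `exists_equiv_borelClassCell_prod`), for each `t` the reparametrisation `t n₀ = η⁻¹ t η` of
`tN(F)` by `η ∈ N(F)` (§2), so that the summand is `Ψ_t(η n)` with `Ψ_t(u) = ψ(u⁻¹ t u)`; then the unfolding
`∫_Ω Σ_{(t,η)} Ψ_t(η n) = Σ_t ∫_{N(𝔸)} Ψ_t` (★ `setIntegral_tsum_prod_smul_eq_tsum_integral`; only finitely many `t`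
meet the support, ★ `finite_setOf_rationalTorus_meets_support`) and the Jacobian-one change of variables (§3).
(Arthur (1978) §8; Rogawski (1990) §7.3 p. 97.) [cite: Arthur1978TraceFormulaI, §8] [cite: Rogawski1990, §2.2 (p. 13); §7.3 (p. 97)] -/
theorem setIntegral_borelSumClass_diag_eq_tsum_integral (hc : c * c = 1) (hc1 : c ≠ 1)
    {cl : (quasiSplit F E c 3).arithmeticSubgroup → ι} (hclN : IsUnipotentInvariantOnBorel F E c 3 cl) (i : ι)
    (hreg : ∀ β : arithmeticBorel F E c 3, cl β = i →
      diagUnit ((mem_arithmeticBorel_iff _).1 β.2) 0 ≠ diagUnit ((mem_arithmeticBorel_iff _).1 β.2) 1 ∧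
      diagUnit ((mem_arithmeticBorel_iff _).1 β.2) 0 ≠ diagUnit ((mem_arithmeticBorel_iff _).1 β.2) 2)
    (ν : Measure (adelicUnipotent F E c 3)) [ν.IsHaarMeasure]
    {Ω : Set (adelicUnipotent F E c 3)} (hΩ : IsFundamentalDomain (rationalUnipotent F E c 3) Ω ν)
    {ψ : (quasiSplit F E c 3).Adelic → ℂ} (hψc : Continuous ψ) (hψ : HasCompactSupport ψ) :
    ∫ n in Ω, borelSumClass cl i ψ ((n : adelicUnipotent F E c 3) : (quasiSplit F E c 3).Adelic)
        ((n : adelicUnipotent F E c 3) : (quasiSplit F E c 3).Adelic) ∂ν =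
      ∑' t : {t : rationalTorus F E c 3 //
          cl ⟨((t : torusAdelic F E c 3) : (quasiSplit F E c 3).Adelic), t.2⟩ = i},
        ∫ m : adelicUnipotent F E c 3,
          ψ ((((t : rationalTorus F E c 3) : torusAdelic F E c 3) : (quasiSplit F E c 3).Adelic) *
            ((m : adelicUnipotent F E c 3) : (quasiSplit F E c 3).Adelic)) ∂ν := by
  obtain ⟨hcN, hcT⟩ := countable_rationalUnipotent_rationalTorus₁₃ (F := F) (E := E) (c := c) (N := 3)
  haveI := hcN
  haveI := hcT
  obtain ⟨hI1, hI2⟩ := smul_instances (F := F) (E := E) (c := c) ν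
  haveI := hI1
  haveI := hI2
  obtain ⟨Ψ, hpt, -, hΨi, hfin, hint⟩ := exists_latticeSum_fibration hc hc1 hclN i hreg ν hψc hψ
  simp_rw [hpt]
  rw [setIntegral_tsum_prod_smul_eq_tsum_integral hΩ hΨi hfin]
  exact tsum_congr hint

/-- **The class Borel lattice sum on the diagonal is integrable on a fundamental domain of `N(F)`** (`N`-regular
class, `ψ ∈ C_c`): `∫_Ω |Σ_{(t,η)} Ψ_t(ηn)| ≤ Σ_t ∫_{N(𝔸)} |Ψ_t| < ∞` (same fibration; Mathlib `lintegral_tsum`,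
`IsFundamentalDomain.lintegral_eq_tsum''`). [cite: Arthur1978TraceFormulaI, §8] [cite: Rogawski1990, §2.2 (p. 13)] -/
theorem integrableOn_borelSumClass_diag (hc : c * c = 1) (hc1 : c ≠ 1)
    {cl : (quasiSplit F E c 3).arithmeticSubgroup → ι} (hclN : IsUnipotentInvariantOnBorel F E c 3 cl) (i : ι)
    (hreg : ∀ β : arithmeticBorel F E c 3, cl β = i →
      diagUnit ((mem_arithmeticBorel_iff _).1 β.2) 0 ≠ diagUnit ((mem_arithmeticBorel_iff _).1 β.2) 1 ∧
      diagUnit ((mem_arithmeticBorel_iff _).1 β.2) 0 ≠ diagUnit ((mem_arithmeticBorel_iff _).1 β.2) 2)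
    (ν : Measure (adelicUnipotent F E c 3)) [ν.IsHaarMeasure]
    {Ω : Set (adelicUnipotent F E c 3)} (hΩ : IsFundamentalDomain (rationalUnipotent F E c 3) Ω ν)
    {ψ : (quasiSplit F E c 3).Adelic → ℂ} (hψc : Continuous ψ) (hψ : HasCompactSupport ψ) :
    IntegrableOn (fun n : adelicUnipotent F E c 3 =>
      borelSumClass cl i ψ ((n : adelicUnipotent F E c 3) : (quasiSplit F E c 3).Adelic)
        ((n : adelicUnipotent F E c 3) : (quasiSplit F E c 3).Adelic)) Ω ν := by
  obtain ⟨hcN, hcT⟩ := countable_rationalUnipotent_rationalTorus₁₃ (F := F) (E := E) (c := c) (N := 3)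
  haveI := hcN
  haveI := hcT
  obtain ⟨hI1, hI2⟩ := smul_instances (F := F) (E := E) (c := c) ν
  haveI := hI1
  haveI := hI2
  obtain ⟨Ψ, hpt, hΨc, hΨi, hfin, -⟩ := exists_latticeSum_fibration hc hc1 hclN i hreg ν hψc hψ
  have heq : (fun n : adelicUnipotent F E c 3 =>
      borelSumClass cl i ψ ((n : adelicUnipotent F E c 3) : (quasiSplit F E c 3).Adelic)
        ((n : adelicUnipotent F E c 3) : (quasiSplit F E c 3).Adelic)) =
      fun n => ∑' p : {t : rationalTorus F E c 3 //
          cl ⟨((t : torusAdelic F E c 3) : (quasiSplit F E c 3).Adelic), t.2⟩ = i} × rationalUnipotent F E c 3,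
        Ψ p.1 (p.2 • n) := funext hpt
  rw [heq]
  -- the translates are measurable
  have hmeas : ∀ p : {t : rationalTorus F E c 3 //
      cl ⟨((t : torusAdelic F E c 3) : (quasiSplit F E c 3).Adelic), t.2⟩ = i} × rationalUnipotent F E c 3,
      Measurable fun n : adelicUnipotent F E c 3 => Ψ p.1 (p.2 • n) := fun p =>
    (hΨc p.1).measurable.comp (measurable_const_smul p.2)
  refine ⟨(Measurable.tsum hmeas).aestronglyMeasurable, ?_⟩
  -- finite integral: `∫⁻_Ω ‖Σ‖ₑ ≤ Σ ∫⁻_Ω ‖·‖ₑ = Σ_t ∫⁻ ‖Ψ_t‖ₑ < ∞`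
  have hlin : ∑' p : {t : rationalTorus F E c 3 //
      cl ⟨((t : torusAdelic F E c 3) : (quasiSplit F E c 3).Adelic), t.2⟩ = i} × rationalUnipotent F E c 3,
        ∫⁻ n in Ω, ‖Ψ p.1 (p.2 • n)‖ₑ ∂ν = ∑' t, ∫⁻ u, ‖Ψ t u‖ₑ ∂ν := by
    rw [ENNReal.tsum_prod']
    exact tsum_congr fun t => (hΩ.lintegral_eq_tsum'' (fun u => ‖Ψ t u‖ₑ)).symm
  refine lt_of_le_of_lt ?_ (lt_top_iff_ne_top.2 (hlin ▸ hfin))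
  calc ∫⁻ n in Ω, ‖∑' p : {t : rationalTorus F E c 3 //
          cl ⟨((t : torusAdelic F E c 3) : (quasiSplit F E c 3).Adelic), t.2⟩ = i} × rationalUnipotent F E c 3,
            Ψ p.1 (p.2 • n)‖ₑ ∂ν
      ≤ ∫⁻ n in Ω, ∑' p : {t : rationalTorus F E c 3 //
          cl ⟨((t : torusAdelic F E c 3) : (quasiSplit F E c 3).Adelic), t.2⟩ = i} × rationalUnipotent F E c 3,
            ‖Ψ p.1 (p.2 • n)‖ₑ ∂ν := lintegral_mono fun n => enorm_tsum_le_tsum_enorm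
    _ = ∑' p : {t : rationalTorus F E c 3 //
          cl ⟨((t : torusAdelic F E c 3) : (quasiSplit F E c 3).Adelic), t.2⟩ = i} × rationalUnipotent F E c 3,
            ∫⁻ n in Ω, ‖Ψ p.1 (p.2 • n)‖ₑ ∂ν :=
        lintegral_tsum fun p => (hmeas p).enorm.aemeasurable

end Unfold

/-! ## §5 The `N(F)\N(𝔸_F)`-average of `D_𝔬 = K_{B,𝔬} − Σ_{B(F)∩𝔬̲}` VANISHES (for an `N`-regular class) -/

section Vanishing

variable [MeasurableSpace (adelicUnipotent F E c 3)] [BorelSpace (adelicUnipotent F E c 3)]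

omit [MeasurableSpace (adelicUnipotent F E c 3)] [BorelSpace (adelicUnipotent F E c 3)] in
/-- The idèlic diagonal of a unipotent element is `1`, so `δ_B(n) = 1` on `N(𝔸_F)`. [cite: Rogawski1990, §1.10] -/
theorem torusRootModulus_diagUnit_eq_one_of_mem_adelicUnipotent {n : (quasiSplit F E c 3).Adelic}
    (hn : n ∈ adelicUnipotent F E c 3) :
    torusRootModulus E 3 (diagUnit (adelicUnipotent_le_borelAdelic hn)) = 1 := by
  have h1 : diagUnit (adelicUnipotent_le_borelAdelic hn) = 1 := by
    have h := diagUnit_eq_diagUnit_torusPart (⟨n, adelicUnipotent_le_borelAdelic hn⟩ : borelAdelic F E c 3)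
    rw [torusPart_eq_one_of_mem (u := ⟨n, adelicUnipotent_le_borelAdelic hn⟩) hn] at h
    rw [show diagUnit (adelicUnipotent_le_borelAdelic hn) =
      diagUnit (⟨n, adelicUnipotent_le_borelAdelic hn⟩ : borelAdelic F E c 3).2 from rfl, h]
    funext j
    refine Units.ext ?_
    rw [coe_diagUnit, OneMemClass.coe_one, map_one, Units.val_one, Matrix.one_apply_eq, Pi.one_apply, Units.val_one]
  rw [h1, torusRootModulus_one]

/-- **The diagonal of the class Borel kernel is constant along `N(𝔸_F)`**: `K_{B,𝔬}(n, n) = K_{B,𝔬}(1, 1)` for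
`n ∈ N(𝔸_F)` (★ `kernelBorelClass_diag_borel_mul` with `δ_B(n) = 1`). [cite: Rogawski1990, §2.2 (p. 13)] -/
theorem kernelBorelClass_diag_unipotent_eq {cl : (quasiSplit F E c 3).arithmeticSubgroup → ι}
    (hc : c * c = 1) (hc1 : c ≠ 1) (ν : Measure (adelicUnipotent F E c 3)) [ν.IsHaarMeasure]
    {𝓕 : Set (adelicUnipotent F E c 3)} (h𝓕 : IsFundamentalDomain (rationalUnipotent F E c 3) 𝓕 ν)
    (hclN : IsUnipotentInvariantOnBorel F E c 3 cl) {f : (quasiSplit F E c 3).Adelic → ℂ} (hfc : Continuous f)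
    (hf : HasCompactSupport f) (n : adelicUnipotent F E c 3) (i : ι) :
    kernelBorelClass ν 𝓕 cl i f ((n : adelicUnipotent F E c 3) : (quasiSplit F E c 3).Adelic)
        ((n : adelicUnipotent F E c 3) : (quasiSplit F E c 3).Adelic) =
      kernelBorelClass ν 𝓕 cl i f 1 1 := by
  have h := kernelBorelClass_diag_borel_mul hc hc1 ν h𝓕 hclN hfc hf
    ⟨((n : adelicUnipotent F E c 3) : (quasiSplit F E c 3).Adelic), adelicUnipotent_le_borelAdelic n.2⟩ 1 i
  rw [mul_one] at h
  rw [h, torusRootModulus_diagUnit_eq_one_of_mem_adelicUnipotent n.2, NNReal.coe_one, one_smul]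

/-- **THE `N(F)\N(𝔸_F)`-AVERAGE OF `D_𝔬` VANISHES FOR AN `N`-REGULAR CLASS**: for `U(J₃)` of a quadratic `E/F`, a
class map `cl` constant along `N(F)` on `B(F)` with class `𝔬 = i` all of whose rational Borel points have
`N`-regular diagonal (`hreg`), a Haar measure `ν` of `N(𝔸_F)`, fundamental domains `𝓕` (in the definition of
`K_{B,𝔬}`) and `Ω` of `N(F)` with `ν(Ω) < ∞`, and `ψ ∈ C_c(G(𝔸_F))`:
`∫_Ω (K_{B,𝔬}(n, n) − Σ_{β ∈ B(F), cl β = i} ψ(n⁻¹βn)) dν(n) = 0` — `K_{B,𝔬}(n,n) = K_{B,𝔬}(1,1) =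
ν(𝓕)⁻¹ Σ_t ∫_{N(𝔸)} ψ(t m) dm` (★ `kernelBorelClass_diag_eq_smul_tsum_integral`), `ν(Ω) = ν(𝓕)` (Mathlib
`IsFundamentalDomain.measure_eq`), and §4. Without `hreg` this FAILS (central class: the orbit `n₀ = 1` alone gives
`ν(Ω) ψ(z)` against `∫_{N(𝔸)} ψ(zu) du` — [Rogawski1990, Prop. 7.3.2]).
[cite: Arthur1978TraceFormulaI, §8] [cite: Rogawski1990, §2.2 (p. 13); §7.3 (p. 97)] -/
theorem setIntegral_kernelBorelClass_diag_sub_borelSumClass_diag_eq_zero (hc : c * c = 1) (hc1 : c ≠ 1)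
    {cl : (quasiSplit F E c 3).arithmeticSubgroup → ι} (hclN : IsUnipotentInvariantOnBorel F E c 3 cl) (i : ι)
    (hreg : ∀ β : arithmeticBorel F E c 3, cl β = i →
      diagUnit ((mem_arithmeticBorel_iff _).1 β.2) 0 ≠ diagUnit ((mem_arithmeticBorel_iff _).1 β.2) 1 ∧
      diagUnit ((mem_arithmeticBorel_iff _).1 β.2) 0 ≠ diagUnit ((mem_arithmeticBorel_iff _).1 β.2) 2)
    (ν : Measure (adelicUnipotent F E c 3)) [ν.IsHaarMeasure]
    {𝓕 : Set (adelicUnipotent F E c 3)} (h𝓕 : IsFundamentalDomain (rationalUnipotent F E c 3) 𝓕 ν)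
    {Ω : Set (adelicUnipotent F E c 3)} (hΩ : IsFundamentalDomain (rationalUnipotent F E c 3) Ω ν) (hΩtop : ν Ω ≠ ⊤)
    {ψ : (quasiSplit F E c 3).Adelic → ℂ} (hψc : Continuous ψ) (hψ : HasCompactSupport ψ) :
    ∫ n in Ω, (kernelBorelClass ν 𝓕 cl i ψ ((n : adelicUnipotent F E c 3) : (quasiSplit F E c 3).Adelic)
          ((n : adelicUnipotent F E c 3) : (quasiSplit F E c 3).Adelic) -
        borelSumClass cl i ψ ((n : adelicUnipotent F E c 3) : (quasiSplit F E c 3).Adelic)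
          ((n : adelicUnipotent F E c 3) : (quasiSplit F E c 3).Adelic)) ∂ν = 0 := by
  obtain ⟨hcN, hcT⟩ := countable_rationalUnipotent_rationalTorus₁₃ (F := F) (E := E) (c := c) (N := 3)
  haveI := hcN
  haveI := hcT
  obtain ⟨hI1, hI2⟩ := smul_instances (F := F) (E := E) (c := c) ν
  haveI := hI1
  haveI := hI2
  -- the `K_{B,𝔬}`-term is the constant `K_{B,𝔬}(1,1)` on `N(𝔸_F)`
  have hK : ∀ n : adelicUnipotent F E c 3,
      kernelBorelClass ν 𝓕 cl i ψ ((n : adelicUnipotent F E c 3) : (quasiSplit F E c 3).Adelic)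
        ((n : adelicUnipotent F E c 3) : (quasiSplit F E c 3).Adelic) = kernelBorelClass ν 𝓕 cl i ψ 1 1 := fun n =>
    kernelBorelClass_diag_unipotent_eq hc hc1 ν h𝓕 hclN hψc hψ n i
  have hKi : IntegrableOn (fun n : adelicUnipotent F E c 3 =>
      kernelBorelClass ν 𝓕 cl i ψ ((n : adelicUnipotent F E c 3) : (quasiSplit F E c 3).Adelic)
        ((n : adelicUnipotent F E c 3) : (quasiSplit F E c 3).Adelic)) Ω ν := by
    simp_rw [hK]
    exact integrableOn_const hΩtop
  rw [integral_sub hKi (integrableOn_borelSumClass_diag hc hc1 hclN i hreg ν hΩ hψc hψ),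
    setIntegral_borelSumClass_diag_eq_tsum_integral hc hc1 hclN i hreg ν hΩ hψc hψ, sub_eq_zero]
  simp_rw [hK]
  rw [setIntegral_const, measureReal_def, kernelBorelClass_diag_eq_smul_tsum_integral ν h𝓕 hclN hψc hψ 1 i,
    hΩ.measure_eq h𝓕, smul_smul]
  -- `ν(𝓕) · ν(𝓕)⁻¹ = 1` (`0 < ν(𝓕) < ∞`)
  have h𝓕top : ν 𝓕 ≠ ⊤ := by rw [← hΩ.measure_eq h𝓕]; exact hΩtop
  have h𝓕0 : ν 𝓕 ≠ 0 := by
    intro h0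
    have huniv : ν Set.univ = 0 := by
      rw [h𝓕.measure_eq_tsum' Set.univ]
      simp [measure_smul, h0]
    exact IsOpenPosMeasure.open_pos (μ := ν) _ isOpen_univ Set.univ_nonempty huniv
  rw [mul_inv_cancel₀ (ENNReal.toReal_ne_zero.2 ⟨h𝓕0, h𝓕top⟩), one_smul]
  refine tsum_congr fun t => ?_
  simp only [inv_one, one_mul, mul_one]

/-- **THE TRANSLATED FORM — `∫_Ω D_𝔬(n g₀) dν(n) = 0` for every `g₀ ∈ G(𝔸_F)`** (the input of (W2-b) FILE 3 after
unfolding and Iwasawa coordinates `g₀ = t k`): `D^f_𝔬(n g₀) = D^{ψ}_𝔬(n)` pointwise with `ψ = f(g₀⁻¹ · g₀) ∈ C_c`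
(both `K_{B,𝔬}` and the lattice sum are built from `y⁻¹ (·) y`), then the previous theorem.
[cite: Arthur1978TraceFormulaI, §8] [cite: Rogawski1990, §2.2 (p. 13); §6.1 (pp. 79–81)] -/
theorem setIntegral_kernelBorelClass_sub_borelSumClass_translate_eq_zero (hc : c * c = 1) (hc1 : c ≠ 1)
    {cl : (quasiSplit F E c 3).arithmeticSubgroup → ι} (hclN : IsUnipotentInvariantOnBorel F E c 3 cl) (i : ι)
    (hreg : ∀ β : arithmeticBorel F E c 3, cl β = i →
      diagUnit ((mem_arithmeticBorel_iff _).1 β.2) 0 ≠ diagUnit ((mem_arithmeticBorel_iff _).1 β.2) 1 ∧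
      diagUnit ((mem_arithmeticBorel_iff _).1 β.2) 0 ≠ diagUnit ((mem_arithmeticBorel_iff _).1 β.2) 2)
    (ν : Measure (adelicUnipotent F E c 3)) [ν.IsHaarMeasure]
    {𝓕 : Set (adelicUnipotent F E c 3)} (h𝓕 : IsFundamentalDomain (rationalUnipotent F E c 3) 𝓕 ν)
    {Ω : Set (adelicUnipotent F E c 3)} (hΩ : IsFundamentalDomain (rationalUnipotent F E c 3) Ω ν) (hΩtop : ν Ω ≠ ⊤)
    {f : (quasiSplit F E c 3).Adelic → ℂ} (hfc : Continuous f) (hf : HasCompactSupport f)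
    (g₀ : (quasiSplit F E c 3).Adelic) :
    ∫ n in Ω, (kernelBorelClass ν 𝓕 cl i f (((n : adelicUnipotent F E c 3) : (quasiSplit F E c 3).Adelic) * g₀)
          (((n : adelicUnipotent F E c 3) : (quasiSplit F E c 3).Adelic) * g₀) -
        borelSumClass cl i f (((n : adelicUnipotent F E c 3) : (quasiSplit F E c 3).Adelic) * g₀)
          (((n : adelicUnipotent F E c 3) : (quasiSplit F E c 3).Adelic) * g₀)) ∂ν = 0 := by
  -- the conjugated test function `ψ = f(g₀⁻¹ · g₀)`
  set ψ : (quasiSplit F E c 3).Adelic → ℂ := fun h => f (g₀⁻¹ * h * g₀) with hψ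
  have hψc : Continuous ψ := hfc.comp ((continuous_const.mul continuous_id).mul continuous_const)
  have hψs : HasCompactSupport ψ :=
    hf.comp_isClosedEmbedding ((Homeomorph.mulLeft g₀⁻¹).trans (Homeomorph.mulRight g₀)).isClosedEmbedding
  -- pointwise `D^f(n g₀) = D^ψ(n)`
  have hS : ∀ y u : (quasiSplit F E c 3).Adelic,
      borelSumClass cl i f (y * g₀) (u * (y * g₀)) = borelSumClass cl i ψ y (u * y) := by
    intro y u
    rw [borelSumClass_def, borelSumClass_def]
    refine tsum_congr fun β => ?_
    simp only [hψ, _root_.mul_inv_rev, mul_assoc]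
  have hpt : ∀ n : adelicUnipotent F E c 3,
      kernelBorelClass ν 𝓕 cl i f (((n : adelicUnipotent F E c 3) : (quasiSplit F E c 3).Adelic) * g₀)
          (((n : adelicUnipotent F E c 3) : (quasiSplit F E c 3).Adelic) * g₀) -
        borelSumClass cl i f (((n : adelicUnipotent F E c 3) : (quasiSplit F E c 3).Adelic) * g₀)
          (((n : adelicUnipotent F E c 3) : (quasiSplit F E c 3).Adelic) * g₀) =
      kernelBorelClass ν 𝓕 cl i ψ ((n : adelicUnipotent F E c 3) : (quasiSplit F E c 3).Adelic)
          ((n : adelicUnipotent F E c 3) : (quasiSplit F E c 3).Adelic) -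
        borelSumClass cl i ψ ((n : adelicUnipotent F E c 3) : (quasiSplit F E c 3).Adelic)
          ((n : adelicUnipotent F E c 3) : (quasiSplit F E c 3).Adelic) := by
    intro n
    have h1 := hS ((n : adelicUnipotent F E c 3) : (quasiSplit F E c 3).Adelic) 1
    rw [one_mul, one_mul] at h1
    rw [h1, kernelBorelClass_def, kernelBorelClass_def, borelConstantTerm_def, borelConstantTerm_def]
    simp_rw [hS]
  simp_rw [hpt]
  exact setIntegral_kernelBorelClass_diag_sub_borelSumClass_diag_eq_zero hc hc1 hclN i hreg ν h𝓕 hΩ hΩtop hψc hψs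

end Vanishing

end UnitaryGroup

end Literature.NumberTheory.Automorphic

end
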